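import Summits.ResolutionOfSingularities.ResolutionOfSingularities.Theorems.FrobeniusClosingPatchingRelPerfectAtomDimLeThree
import HarnessLib

/-!
# Crux `PatchingRelPerfect` (stmt-ResolutionOfSingularities-16161), line `closed-point-slice`
# (skeleton v4, lead res-L1-w52-lead-1, sha `ce6a1f2d…`): stub `stub_geomAtomLeThree` —
# local desingularization over points of local dimension `≤ 3` of varieties over any field

[OURS · L1 W5.2] The registered stub `stub_geomAtomLeThree` (TRUE modulo the printed inputs,
delegated to stub-1 by the lead's RESHAPED line 2026-08-26T18:38Z), verbatim: for any field `k`,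
an integral `k`-scheme `N` locally of finite type, a point `y ∈ N` with `dim 𝒪_{N,y} ≤ 3`, and
`T` integral, proper and birational over `Spec 𝒪_{N,y}`, the scheme `T` admits a
desingularization in Temkin's sense (ONE blowing up along an ideal sheaf cosupported in `Sing T`,
with regular source), modulo Cossart–Piltant 2019 Thm. 1.1 (`hG`), Prop. 4.4 (`hP`) and
Cossart–Jannsen–Saito 2020 Thm. 1.2 in single-blow-up format (`hCJS`).

The proof is that of the landed `stub_atomDimLeThree` (p170764; complete base) with ONE change:
excellence of the base `𝒪_{N,y}` comes from `Picover.LocalBlowups.isExcellentRing_stalk`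
(localization of a finite type algebra over a field) instead of completeness; the conclusion is
Temkin's format itself (centre in `Sing T`), so no off-fibre hypothesis is needed.
* `T` is Noetherian, separated, excellent, of dimension `≤ 3`
  (`topologicalKrullDim_le_of_isProper_of_isBirational`);
* `dim T ≤ 2`: `hCJS` verbatim;
* `dim T = 3`: `hG` gives a strong resolution `φ : Y → T`, an isomorphism over `W = Reg T`; `Y` is
  integral, excellent, of dimension exactly `3`, so Prop. 4.4 in blow-up format
  (`formatPrincipalization_dim3_of_cossartPiltant hP`) is Axiom 4 on `Y`, and the twin crux's
  format upgrade `exists_isBlowup_supported_isRegular_of_isIso_over` yields ONE blowing up of `T`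
  cosupported in `T ∖ W = Sing T` with regular source.

## Sources

* V. Cossart, O. Piltant, J. Algebra 529 (2019), Thm. 1.1 and Prop. 4.4. [CossartPiltant2019]
* V. Cossart, U. Jannsen, S. Saito, LNM 2270 (2020), Thm. 1.2. [CossartJannsenSaito2020]
* M. Temkin, Adv. Math. 219 (2008), Def. 2.2.6, Lemma 2.1.4. [Temkin2008]
* The Stacks Project, Tags 081T, 080A, 07QW. [StacksProject]
-/

set_option linter.dupNamespace false -- single-problem summit: doubled namespace component is forced

noncomputable section

open CategoryTheory CategoryTheory.Limits AlgebraicGeometry Literature.AlgebraicGeometry.Resolution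
open TopologicalSpace IsLocalRing

namespace Summit.ResolutionOfSingularities.ResolutionOfSingularities.Theorems

/-- **Local desingularization over points of local dimension `≤ 3`** (stub
`stub_geomAtomLeThree` of skeleton v4 of line `closed-point-slice`, registered signature
verbatim; TRUE modulo the printed inputs). For any field `k`, `N` integral locally of finite type
over `k`, `y ∈ N` with `dim 𝒪_{N,y} ≤ 3` and `h : T → Spec 𝒪_{N,y}` proper birational with `T`
integral: `𝒪_{N,y}` is an excellent Noetherian local domain (`isExcellentRing_stalk`), so `T` is
Noetherian, separated, excellent of dimension `≤ 3`; if `dim T ≤ 2` Cossart–Jannsen–Saito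
(`hCJS`) desingularizes it; if `dim T = 3` Cossart–Piltant Thm. 1.1 (`hG`) gives a strong
resolution `φ : Y → T`, an isomorphism over `Reg T`, `Y` excellent of dimension exactly `3`, and
Prop. 4.4 in blow-up format (`formatPrincipalization_dim3_of_cossartPiltant hP`) with the format
upgrade `exists_isBlowup_supported_isRegular_of_isIso_over` turns it into ONE blowing up
cosupported in `Sing T` with regular source — a desingularization in Temkin's sense.
[cite: CossartPiltant2019, Thm. 1.1 and Prop. 4.4; CossartJannsenSaito2020, Thm. 1.2;
Temkin2008, Def. 2.2.6 and Lemma 2.1.4] -/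
theorem stub_geomAtomLeThree
    (hG : CossartPiltant2019General.{0}) (hP : CossartPiltant2019Principalization.{0})
    (hCJS : ∀ (X : Scheme.{0}) [IsNoetherian X] [IsReduced X], Scheme.IsExcellent X →
      topologicalKrullDim X ≤ 2 → Scheme.AdmitsDesingularization X)
    (k : Type) [Field k] (N : Scheme.{0}) (gN : N ⟶ Spec (.of k)) [LocallyOfFiniteType gN]
    [IsIntegral N] (y : N) (hd : ringKrullDim (N.presheaf.stalk y) ≤ (3 : ℕ)) (T : Scheme.{0})
    (h : T ⟶ Spec (N.presheaf.stalk y)) [IsIntegral T] [IsProper h] (hbir : IsBirational h) :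
    Scheme.AdmitsDesingularization T := by
  -- the base: an integral Noetherian excellent local domain of dimension `≤ 3`
  haveI : IsLocallyNoetherian N := LocallyOfFiniteType.isLocallyNoetherian gN
  have hexcS : IsExcellentRing (N.presheaf.stalk y) :=
    Picover.LocalBlowups.isExcellentRing_stalk gN y
  haveI : IsNoetherianRing (N.presheaf.stalk y) := inferInstance
  haveI : IsNoetherian (Spec (N.presheaf.stalk y)) := inferInstance
  have hdimS : topologicalKrullDim (Spec (N.presheaf.stalk y)) ≤ (3 : ℕ) := by
    change topologicalKrullDim (PrimeSpectrum (N.presheaf.stalk y)) ≤ _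
    rw [PrimeSpectrum.topologicalKrullDim_eq_ringKrullDim]
    exact hd
  -- `T` is Noetherian, separated, excellent, of dimension `≤ 3`
  haveI : IsLocallyNoetherian T := LocallyOfFiniteType.isLocallyNoetherian h
  haveI : CompactSpace T := QuasiCompact.compactSpace_of_compactSpace h
  haveI : IsNoetherian T := {}
  haveI : T.IsSeparated := Scheme.isSeparated_of_isSeparated_over h
  have hexc : Scheme.IsExcellent T :=
    Picover.LocalBlowups.isExcellent_of_locallyOfFiniteType_of_isExcellentRing hexcS h
  have hdimT : topologicalKrullDim T ≤ (3 : ℕ) :=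
    topologicalKrullDim_le_of_isProper_of_isBirational h hbir hdimS
  by_cases h2 : topologicalKrullDim T ≤ 2
  · -- dimension `≤ 2`: Cossart–Jannsen–Saito
    exact hCJS T hexc h2
  · -- dimension `3`: Cossart–Piltant Thm. 1.1 + Prop. 4.4 through the format upgrade
    have hdimT3 : topologicalKrullDim T = 3 :=
      le_antisymm (by exact_mod_cast hdimT) (Picover.LocalBlowups.three_le_of_not_le_two h2)
    obtain ⟨Y, φ, hres, W, hW, hiso⟩ := hG T hexc.isQuasiExcellent hdimT3.le
    haveI := hres.isProper
    haveI := hiso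
    haveI : IsIntegral Y := by
      haveI := hres.isRegular.isReduced
      exact hres.isBirational.isIntegral
    have hgenW : genericPoint T ∈ W := by
      show genericPoint T ∈ (W : Set T)
      rw [hW]
      exact genericPoint_mem_regularLocus T
    -- `Y` is Noetherian and excellent (of finite type over `𝒪_{N,y}` via `φ ≫ h`) of dimension `3`
    haveI : IsLocallyNoetherian Y := LocallyOfFiniteType.isLocallyNoetherian φ
    haveI : CompactSpace Y := QuasiCompact.compactSpace_of_compactSpace φ
    haveI : IsNoetherian Y := {}
    have hexcY : Scheme.IsExcellent Y :=
      Picover.LocalBlowups.isExcellent_of_locallyOfFiniteType_of_isExcellentRing hexcS (φ ≫ h)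
    have hdimY : topologicalKrullDim Y = 3 := by
      apply le_antisymm
      · exact_mod_cast topologicalKrullDim_le_of_isProper_of_isBirational (φ ≫ h)
          (hres.isBirational.comp hbir) hdimS
      · haveI : Surjective φ := ⟨hres.isBirational.surjective_of_universallyClosed⟩
        rw [← hdimT3]
        exact Literature.AlgebraicGeometry.Motives.Scheme.topologicalKrullDim_le_of_universallyClosed_of_surjective
          φ
    -- Axiom 4 on `Y`: Cossart–Piltant Prop. 4.4 in blow-up format
    have hA4 : ∀ I' : Y.IdealSheafData, I' ≠ ⊥ →
        ∃ (Q : Y.IdealSheafData) (Y₁ : Scheme.{0}) (σ : Y₁ ⟶ Y),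
          (Q.support : Set Y) ⊆ I'.support ∧ IsBlowup σ Q ∧ Scheme.IsRegular Y₁ ∧
            IsEffectiveCartier (I'.comap σ) := fun I' hI' =>
      formatPrincipalization_dim3_of_cossartPiltant hP Y hres.isRegular hexcY hdimY I' hI'
    -- the format upgrade: ONE `Sing T`-supported blowing up with regular source
    obtain ⟨Q', V'', ρ, -, hQ'T, hρ, hreg''⟩ :=
      exists_isBlowup_supported_isRegular_of_isIso_over φ W hgenW hA4
    refine ⟨V'', ρ, ⟨Q', hρ, fun t ht hreg => hQ'T ht ?_⟩, hreg''⟩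
    show t ∈ (W : Set T)
    rw [hW]
    exact hreg

end Summit.ResolutionOfSingularities.ResolutionOfSingularities.Theorems

end
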